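import Summits.CriticalPhenomena.SAWScalingLimit.Theorems.SAWTotalPositivityCriticalBubbleBoundDockingDefs
import Literature.Probability.RandomPlanarGeometry.SAWPolygonSurgery

/-!
# Rooted polygons of self-avoiding walks as edge sets (line `docking-census-joining`, stub S1)

Crux `stmt-CriticalPhenomena-7117`
(`Summit.CriticalPhenomena.SAWScalingLimit.Theses.SAWTotalPositivity.CriticalBubbleBound`), line
`docking-census-joining`, helper file of the registered stub `stub_dockingInjection`
(objects `verts`, `pedges`, `rootEdge`, `shift` of `…Theorems.SAWTotalPositivityCriticalBubbleBoundDockingDefs`).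

The dictionary between the function model `ω ∈ Zd.sawFun 2 n e₀` (an `n`-step self-avoiding walk
`0 → e₀`, frozen after time `n`) and the tree's polygons `IsPolygon (zdGraph 2) E` (edge sets of
cycles):

* `image_getVert_eq_edges_toFinset` — the edges of a Mathlib walk are the pairs of consecutive
  `getVert`s;
* `exists_mem_pedges_iff` — the vertices of the rooted polygon `pedges n η` are `verts n η`;
* `pedges_shift_isPolygon` — for `ω ∈ sawFun 2 n e₀`, `n ≥ 2`, the translate `pedges n (shift v ω)`
  (the `n` steps of `ω + v` and the root edge `{v + e₀, v}`) is a polygon with `n + 1` edges;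
* `eq_of_pedges_shift_eq` — `ω ↦ pedges n (shift v ω)` is injective on `sawFun 2 n e₀` (`n ≥ 2`):
  a self-avoiding walk is determined by its endpoints and its edge set;
* `exists_sawFun_of_isPolygon` — OPENING AT THE ROOT: a polygon `C ∋ rootEdge = {0, e₀}` with
  `n + 1` edges is `pedges n χ` for some `χ ∈ sawFun 2 n e₀`;
* bookkeeping: `rootEdge_mem_pedges_of_mem_sawFun`, `root_shift_mem_pedges`, `two_le_of_mem_pedges`, `shift_by_zero`.

Sources: N. Madras, G. Slade, *The Self-Avoiding Walk* (1993), Definition 3.2.1 (a polygon is an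
`(N-1)`-step self-avoiding walk with adjacent endpoints plus the closing bond). All [folklore].
-/

noncomputable section

open Literature.Probability.LatticeModels
open Literature.Probability.RandomPlanarGeometry Literature.Probability.RandomPlanarGeometry.SAW
open scoped BigOperators
open Summit.CriticalPhenomena.SAWScalingLimit.Theorems.CriticalBubbleBound.Negative (e₀)

namespace Summit.CriticalPhenomena.SAWScalingLimit.Theorems.CriticalBubbleBound.Docking

/-! ## Edges of a walk from consecutive vertices -/

section Generic

variable {V : Type*} {G : SimpleGraph V}

/-- Consecutive vertices of a walk span an edge of the walk. [folklore] -/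
theorem mk_getVert_mem_edges {u v : V} (p : G.Walk u v) :
    ∀ i < p.length, s(p.getVert i, p.getVert (i + 1)) ∈ p.edges := by
  induction p with
  | nil => intro i hi; simp at hi
  | @cons a b c h p' ih =>
    intro i hi
    cases i with
    | zero => simp [SimpleGraph.Walk.getVert_cons_succ]
    | succ i =>
      rw [SimpleGraph.Walk.length_cons] at hi
      simp only [SimpleGraph.Walk.getVert_cons_succ, SimpleGraph.Walk.edges_cons]
      exact List.mem_cons_of_mem _ (ih i (by omega))

/-- Every edge of a walk is spanned by two consecutive vertices. [folklore] -/
theorem exists_getVert_of_mem_edges {u v : V} (p : G.Walk u v) :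
    ∀ e ∈ p.edges, ∃ i < p.length, e = s(p.getVert i, p.getVert (i + 1)) := by
  induction p with
  | nil => simp
  | @cons a b c h p' ih =>
    intro e he
    rw [SimpleGraph.Walk.edges_cons, List.mem_cons] at he
    rcases he with rfl | he
    · exact ⟨0, by simp, by simp [SimpleGraph.Walk.getVert_cons_succ]⟩
    · obtain ⟨i, hi, rfl⟩ := ih e he
      exact ⟨i + 1, by simp only [SimpleGraph.Walk.length_cons]; omega,
        by simp [SimpleGraph.Walk.getVert_cons_succ]⟩

/-- The edge set of a walk is the set of pairs of consecutive vertices. [folklore] -/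
theorem image_getVert_eq_edges_toFinset [DecidableEq V] {u v : V} (p : G.Walk u v) :
    (Finset.range p.length).image (fun i => s(p.getVert i, p.getVert (i + 1))) =
      p.edges.toFinset := by
  ext e
  simp only [Finset.mem_image, Finset.mem_range, List.mem_toFinset]
  constructor
  · rintro ⟨i, hi, rfl⟩
    exact mk_getVert_mem_edges p i hi
  · intro he
    obtain ⟨i, hi, rfl⟩ := exists_getVert_of_mem_edges p e he
    exact ⟨i, hi, rfl⟩

end Generic

/-! ## Vertices and edges of rooted polygons -/

/-- The vertices lying on the edges of the rooted polygon `pedges n η` are exactly `verts n η`.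
[folklore] -/
theorem exists_mem_pedges_iff {n : ℕ} {η : ℕ → Site 2} {x : Site 2} :
    (∃ e ∈ pedges n η, x ∈ e) ↔ x ∈ verts n η := by
  constructor
  · rintro ⟨e, he, hx⟩
    rw [pedges, Finset.mem_insert, Finset.mem_image] at he
    rw [verts, Finset.mem_image]
    rcases he with rfl | ⟨i, hi, rfl⟩
    · rcases Sym2.mem_iff.1 hx with rfl | rfl
      · exact ⟨n, Finset.mem_range.2 (Nat.lt_succ_self n), rfl⟩
      · exact ⟨0, Finset.mem_range.2 (Nat.succ_pos n), rfl⟩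
    · rw [Finset.mem_range] at hi
      rcases Sym2.mem_iff.1 hx with rfl | rfl
      · exact ⟨i, Finset.mem_range.2 (by omega), rfl⟩
      · exact ⟨i + 1, Finset.mem_range.2 (by omega), rfl⟩
  · intro hx
    rw [verts, Finset.mem_image] at hx
    obtain ⟨i, hi, rfl⟩ := hx
    rw [Finset.mem_range] at hi
    rcases Nat.lt_or_ge i n with h | h
    · refine ⟨s(η i, η (i + 1)), ?_, Sym2.mem_mk_left _ _⟩
      rw [pedges, Finset.mem_insert, Finset.mem_image]
      exact Or.inr ⟨i, Finset.mem_range.2 h, rfl⟩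
    · obtain rfl : i = n := by omega
      exact ⟨s(η i, η 0), by rw [pedges]; exact Finset.mem_insert_self _ _, Sym2.mem_mk_left _ _⟩

/-- The walk traced by an injective nearest-neighbour function on `[0, n]`: it is self-avoiding,
its edges are the `n` steps, and (for `n ≥ 2`) the closing pair `{η 0, η n}` is not among them.
[folklore] -/
theorem walkOfFn_spec {n : ℕ} {η : ℕ → Site 2} (hadj : ∀ i < n, (zdGraph 2).Adj (η i) (η (i + 1)))
    (hinj : Set.InjOn η {i | i ≤ n}) (hn : 2 ≤ n) :
    (Zd.walkOfFn η n hadj).IsPath ∧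
      (Zd.walkOfFn η n hadj).edges.toFinset =
        (Finset.range n).image (fun i => s(η i, η (i + 1))) ∧
      s(η 0, η n) ∉ (Zd.walkOfFn η n hadj).edges := by
  have hWe : (Zd.walkOfFn η n hadj).edges.toFinset =
      (Finset.range n).image (fun i => s(η i, η (i + 1))) := by
    rw [← image_getVert_eq_edges_toFinset, Zd.length_walkOfFn]
    refine Finset.image_congr fun i hi => ?_
    have hi' : i < n := Finset.mem_range.1 (Finset.mem_coe.1 hi)
    simp only [Zd.getVert_walkOfFn, min_eq_left hi'.le, min_eq_left (Nat.succ_le_of_lt hi')]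
  refine ⟨?_, hWe, ?_⟩
  · rw [← SimpleGraph.Walk.IsPath.getVert_injOn_iff]
    intro i hi j hj hij
    simp only [Set.mem_setOf_eq, Zd.length_walkOfFn] at hi hj
    simp only [Zd.getVert_walkOfFn, min_eq_left hi, min_eq_left hj] at hij
    exact hinj hi hj hij
  · intro h
    have h' : s(η 0, η n) ∈ (Zd.walkOfFn η n hadj).edges.toFinset := List.mem_toFinset.2 h
    rw [hWe, Finset.mem_image] at h'
    obtain ⟨i, hi, he⟩ := h'
    rw [Finset.mem_range] at hi
    have h0 : (0 : ℕ) ∈ {i | i ≤ n} := Nat.zero_le n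
    have hn' : n ∈ {i | i ≤ n} := le_refl n
    have hi1 : i ∈ {i | i ≤ n} := hi.le
    have hi2 : i + 1 ∈ {i | i ≤ n} := Nat.succ_le_of_lt hi
    rcases Sym2.eq_iff.1 he with ⟨h1, h2⟩ | ⟨h1, h2⟩
    · have := hinj hi1 h0 h1
      have := hinj hi2 hn' h2
      omega
    · have := hinj hi2 h0 h2
      omega

/-- The rooted polygon of an injective nearest-neighbour function on `[0, n]` (`n ≥ 2`) with
adjacent ends is a polygon with `n + 1` edges. [cite: MadrasSlade1993, Definition 3.2.1] -/
theorem isPolygon_pedges_of_injOn {n : ℕ} {η : ℕ → Site 2}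
    (hadj : ∀ i < n, (zdGraph 2).Adj (η i) (η (i + 1))) (hinj : Set.InjOn η {i | i ≤ n})
    (hclose : (zdGraph 2).Adj (η n) (η 0)) (hn : 2 ≤ n) :
    IsPolygon (zdGraph 2) (pedges n η) ∧ (pedges n η).card = n + 1 := by
  obtain ⟨hWp, hWe, hnot⟩ := walkOfFn_spec hadj hinj hn
  have hP := isPolygon_insert_of_isPath hWp hclose hnot
  have hpe : pedges n η = insert s(η 0, η n) (Zd.walkOfFn η n hadj).edges.toFinset := by
    rw [pedges, hWe, Sym2.eq_swap]
  rw [hpe, hP.2, Zd.length_walkOfFn]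
  exact ⟨hP.1, rfl⟩

/-- Two injective nearest-neighbour functions with the same ends, frozen after time `n ≥ 2`, and
the same rooted polygon coincide (a self-avoiding walk is determined by its endpoints and its edge
set). [folklore] -/
theorem eq_of_pedges_eq {n : ℕ} {η₁ η₂ : ℕ → Site 2} {a b : Site 2}
    (h0₁ : η₁ 0 = a) (h0₂ : η₂ 0 = a) (he₁ : ∀ i, n ≤ i → η₁ i = b) (he₂ : ∀ i, n ≤ i → η₂ i = b)
    (hadj₁ : ∀ i < n, (zdGraph 2).Adj (η₁ i) (η₁ (i + 1)))
    (hadj₂ : ∀ i < n, (zdGraph 2).Adj (η₂ i) (η₂ (i + 1)))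
    (hinj₁ : Set.InjOn η₁ {i | i ≤ n}) (hinj₂ : Set.InjOn η₂ {i | i ≤ n}) (hn : 2 ≤ n)
    (h : pedges n η₁ = pedges n η₂) : η₁ = η₂ := by
  classical
  obtain ⟨hW₁p, hW₁e, hnot₁⟩ := walkOfFn_spec hadj₁ hinj₁ hn
  obtain ⟨hW₂p, hW₂e, hnot₂⟩ := walkOfFn_spec hadj₂ hinj₂ hn
  -- the step edge sets agree
  have hsteps : ∀ {η : ℕ → Site 2}, s(η 0, η n) ∉ (Finset.range n).image (fun i => s(η i, η (i + 1))) →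
      (Finset.range n).image (fun i => s(η i, η (i + 1))) = (pedges n η).erase s(η n, η 0) := by
    intro η hη
    rw [pedges, Finset.erase_insert]
    rwa [Sym2.eq_swap]
  have hst₁ := hsteps (η := η₁) (by rw [← hW₁e, List.mem_toFinset]; exact hnot₁)
  have hst₂ := hsteps (η := η₂) (by rw [← hW₂e, List.mem_toFinset]; exact hnot₂)
  have hends : s(η₁ n, η₁ 0) = s(η₂ n, η₂ 0) := by rw [he₁ n le_rfl, he₂ n le_rfl, h0₁, h0₂]
  have hedges : ((Zd.walkOfFn η₁ n hadj₁).copy h0₁ (he₁ n le_rfl)).edges.toFinset =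
      ((Zd.walkOfFn η₂ n hadj₂).copy h0₂ (he₂ n le_rfl)).edges.toFinset := by
    rw [SimpleGraph.Walk.edges_copy, SimpleGraph.Walk.edges_copy, hW₁e, hW₂e, hst₁, hst₂, h, hends]
  have hW : (Zd.walkOfFn η₁ n hadj₁).copy h0₁ (he₁ n le_rfl) =
      (Zd.walkOfFn η₂ n hadj₂).copy h0₂ (he₂ n le_rfl) :=
    eq_of_isPath_of_edges_toFinset_eq (by simpa using hW₁p) (by simpa using hW₂p) hedges
  funext i
  rcases le_or_gt i n with hi | hi
  · have := congrArg (fun w => SimpleGraph.Walk.getVert w i) hW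
    simpa [Zd.getVert_walkOfFn, min_eq_left hi] using this
  · rw [he₁ i hi.le, he₂ i hi.le]

/-! ## Translates of self-avoiding walks -/

/-- `shift v ω i = ω i + v`. [folklore] -/
@[simp] theorem shift_eval (v : Site 2) (ω : ℕ → Site 2) (i : ℕ) : shift v ω i = ω i + v := rfl

/-- Translating by `0` does nothing. [folklore] -/
theorem shift_by_zero (ω : ℕ → Site 2) : shift 0 ω = ω := funext fun i => add_zero (ω i)

/-- The translate `ω + v` of `ω ∈ sawFun 2 n e₀`: it starts at `v`, is frozen at `e₀ + v` from
time `n`, makes nearest-neighbour steps and is injective on `[0, n]`. [cite: MadrasSlade1993, §1.1] -/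
theorem shift_spec {n : ℕ} {ω : ℕ → Site 2} (hω : ω ∈ Zd.sawFun 2 n e₀) (v : Site 2) :
    shift v ω 0 = v ∧ (∀ i, n ≤ i → shift v ω i = e₀ + v) ∧
      (∀ i < n, (zdGraph 2).Adj (shift v ω i) (shift v ω (i + 1))) ∧
      Set.InjOn (shift v ω) {i | i ≤ n} := by
  obtain ⟨h0, hend, hadj, hinj⟩ := Zd.mem_sawFun.1 hω
  refine ⟨by simp [h0], fun i hi => by simp [hend i hi], fun i hi => ?_, fun i hi j hj hij => ?_⟩
  · simpa only [shift_eval, Zd.zdGraph_adj_add_right] using hadj i hi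
  · exact hinj hi hj (add_right_cancel hij)

/-- **The translated rooted polygon is a polygon.** For `ω ∈ sawFun 2 n e₀`, `n ≥ 2`, the edge set
`pedges n (shift v ω)` (the `n` steps of `ω + v` and the root edge `{e₀ + v, v}`) is a polygon of
`ℤ²` with `n + 1` edges. [cite: MadrasSlade1993, Definition 3.2.1] -/
theorem pedges_shift_isPolygon {n : ℕ} {ω : ℕ → Site 2} (hω : ω ∈ Zd.sawFun 2 n e₀) (hn : 2 ≤ n)
    (v : Site 2) :
    IsPolygon (zdGraph 2) (pedges n (shift v ω)) ∧ (pedges n (shift v ω)).card = n + 1 := by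
  obtain ⟨h0, hend, hadj, hinj⟩ := shift_spec hω v
  refine isPolygon_pedges_of_injOn hadj hinj ?_ hn
  rw [hend n le_rfl, h0]
  simpa using (Zd.zdGraph_adj_add_right e₀ 0 v).2 Negative.adj_zero_e₀.symm

/-- **A self-avoiding walk is determined by its translated rooted polygon**: for `n ≥ 2`,
`ω ↦ pedges n (shift v ω)` is injective on `sawFun 2 n e₀`. [folklore] -/
theorem eq_of_pedges_shift_eq {n : ℕ} {ω₁ ω₂ : ℕ → Site 2} (h₁ : ω₁ ∈ Zd.sawFun 2 n e₀)
    (h₂ : ω₂ ∈ Zd.sawFun 2 n e₀) (hn : 2 ≤ n) {v : Site 2}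
    (h : pedges n (shift v ω₁) = pedges n (shift v ω₂)) : ω₁ = ω₂ := by
  obtain ⟨a₁, b₁, c₁, d₁⟩ := shift_spec h₁ v
  obtain ⟨a₂, b₂, c₂, d₂⟩ := shift_spec h₂ v
  have hs := eq_of_pedges_eq a₁ a₂ b₁ b₂ c₁ c₂ d₁ d₂ hn h
  funext i
  exact add_right_cancel (congrFun hs i)

/-- The root edge `{0, e₀}` is an edge of the rooted polygon of `ω ∈ sawFun 2 n e₀`.
[cite: MadrasSlade1993, Definition 3.2.1] -/
theorem rootEdge_mem_pedges_of_mem_sawFun {n : ℕ} {ω : ℕ → Site 2} (hω : ω ∈ Zd.sawFun 2 n e₀) :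
    rootEdge ∈ pedges n ω := by
  obtain ⟨h0, hend, -, -⟩ := Zd.mem_sawFun.1 hω
  rw [pedges, hend n le_rfl, h0, rootEdge, Sym2.eq_swap]
  exact Finset.mem_insert_self _ _

/-- The root edge `{v, v + e₀}` of the translated rooted polygon. [cite: MadrasSlade1993, Definition 3.2.1] -/
theorem root_shift_mem_pedges {n : ℕ} {ω : ℕ → Site 2} (hω : ω ∈ Zd.sawFun 2 n e₀) (v : Site 2) :
    s(v, v + e₀) ∈ pedges n (shift v ω) := by
  obtain ⟨h0, hend, -, -⟩ := shift_spec hω v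
  rw [pedges, hend n le_rfl, h0, add_comm e₀ v, Sym2.eq_swap]
  exact Finset.mem_insert_self _ _

/-- A rooted polygon with an edge other than the root edge comes from a walk with at least two
steps (`sawFun 2 0 e₀ = ∅`, and for `n = 1` the only edge is the root edge). [folklore] -/
theorem two_le_of_mem_pedges {n : ℕ} {ω : ℕ → Site 2} (hω : ω ∈ Zd.sawFun 2 n e₀)
    {f : Sym2 (Site 2)} (hf : f ∈ pedges n ω) (hfr : f ≠ rootEdge) : 2 ≤ n := by
  obtain ⟨h0, hend, -, -⟩ := Zd.mem_sawFun.1 hω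
  by_contra hn
  push Not at hn
  have hroot : s(ω n, ω 0) = rootEdge := by rw [hend n le_rfl, h0, rootEdge, Sym2.eq_swap]
  rw [pedges, hroot, Finset.mem_insert, Finset.mem_image] at hf
  rcases hf with hf | ⟨i, hi, rfl⟩
  · exact hfr hf
  · rw [Finset.mem_range] at hi
    obtain rfl : n = 1 := by omega
    obtain rfl : i = 0 := by omega
    exact hfr (by rw [h0, hend 1 le_rfl, rootEdge])

/-! ## Opening a polygon at the root edge -/

/-- **Opening at the root.** A polygon of `ℤ²` through the root edge `{0, e₀}` with `n + 1` edges is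
the rooted polygon `pedges n χ` of some `χ ∈ sawFun 2 n e₀` (trace the cycle minus the root edge
from `0` to `e₀`). [cite: MadrasSlade1993, Definition 3.2.1] -/
theorem exists_sawFun_of_isPolygon {C : Finset (Sym2 (Site 2))} (hC : IsPolygon (zdGraph 2) C)
    (hr : rootEdge ∈ C) {n : ℕ} (hn : C.card = n + 1) :
    ∃ χ ∈ Zd.sawFun 2 n e₀, pedges n χ = C := by
  classical
  obtain ⟨P, hP, hPe, -, hPl, -⟩ := hC.exists_isPath_erase (a := (0 : Site 2)) (b := e₀) hr
  have hlen : P.length = n := by omega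
  refine ⟨fun i => P.getVert i, Zd.mem_sawFun.2 ⟨P.getVert_zero, fun i hi => ?_, fun i hi => ?_, ?_⟩,
    ?_⟩
  · exact P.getVert_of_length_le (hlen ▸ hi)
  · exact P.adj_getVert_succ (hlen ▸ hi)
  · have := hP.getVert_injOn
    rwa [hlen] at this
  · rw [pedges, P.getVert_zero, P.getVert_of_length_le hlen.le, ← hlen,
      image_getVert_eq_edges_toFinset, hPe]
    have : s(e₀, (0 : Site 2)) = rootEdge := by rw [rootEdge, Sym2.eq_swap]
    rw [this]
    exact Finset.insert_erase hr

/-- **Registered sub-goal `exists_sawFun_pedges_eq`** (opening at the root, the form used by the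
docking injection): every polygon of `ℤ²` through the root edge with `n + 1` edges is the rooted
polygon of an `n`-step self-avoiding walk `0 → e₀`. [cite: MadrasSlade1993, Definition 3.2.1] -/
theorem exists_sawFun_pedges_eq :
    ∀ (C : Finset (Sym2 (Site 2))) (n : ℕ), IsPolygon (zdGraph 2) C → rootEdge ∈ C →
      C.card = n + 1 → ∃ χ ∈ Zd.sawFun 2 n e₀, pedges n χ = C :=
  fun _ _ hC hr hn => exists_sawFun_of_isPolygon hC hr hn

end Summit.CriticalPhenomena.SAWScalingLimit.Theorems.CriticalBubbleBound.Docking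

end
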